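import Summits.Langlands.Langlands.Theses.EvenIcosahedralCMCorner
import Literature.NumberTheory.Automorphic.OrdinaryCompletedCohomologyGL

/-!
# Strategy census companion — crux `ArtinPointClassicalityCM` (stmt-Langlands-14075)

Crux-strategist seat `planner-cstrat-stmt-Langlands-14075-r1-0` (route re-audit bin RESTATED,
route `route-Langlands-EvenIcosahedralCMCorner`).  This file TYPES the two decompositions of the
crux that can be written over the tree today and PROVES their assemblies, so that the verdicts of
`STRATEGY-CENSUS.md` §4 ("Decomposition") are checkable:

* **D1 (Buzzard–Taylor transfer: companions + gluing + residue).**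
  `CompanionPointsCM → OrdinaryGluingCM → NonDistinguishedResidueCM → ArtinPointClassicalityCM`
  (`artinPointClassicalityCM_of_companions`).  The seam is a COMPOSITION through the intermediate
  statement "every ordinary refinement of `τ₃` carries a continuous point of Hida's ordinary big
  Hecke algebra `𝕋^{S,ord}(𝒰)` with the prescribed `U_{w,1}`-eigenvalues" (`HasCompanionPoint`),
  plus excluded middle on "3-distinguished"; the proof is four lines — a trivial seam in the sense
  of the BC2 redirect rule (b).
* **D2 (Galois-type sectors: odd-descending / non-odd-descending / genuine).**
  `OddDescendingSector → NonOddDescendingSector → GenuineSector → ArtinPointClassicalityCM`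
  (`artinPointClassicalityCM_of_sectors`) and conversely each sector is the crux restricted
  (`sectors_of_artinPointClassicalityCM`): excluded middle on two predicates — a trivial seam (b).

Nothing here is filed as an item; see the census for why (each split violates (b), and the piece
that would become the route's leaf — `OrdinaryGluingCM`, resp. `NonOddDescendingSector` — is the
wall again on the route's own instances).
-/

noncomputable section

open scoped MatrixGroups Matrix NumberField Polynomial Classical
open NumberField IsDedekindDomain Field Polynomial Filter
open Literature.NumberTheory.Automorphic Literature.NumberTheory.GaloisRepresentations
open Literature.NumberTheory.Automorphic.BigHeckeGLn
open Summit.Langlands.Langlands.Theses.EvenIcosahedralCMCorner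

namespace Summit.Langlands.Langlands.Cruxes.ArtinPointClassicalityCM.StrategyCensus

section Vocabulary

variable {M : Type} [Field M] [NumberField M]

/-- The CONCLUSION of the crux: `τ` is automorphic over `M` in Tunnell's a.e. sense (a cuspidal
`π` on `GL₂(𝔸_M)` whose Satake parameters are the arithmetic-Frobenius eigenvalues of `τ` at all
but finitely many places). Verbatim the crux's `∃ hM π, ∀ᶠ w, …` clause. -/
def IsAutomorphicAE (τ : FramedGaloisRep M ℂ 2) : Prop :=
  ∃ (hM : isCompact_glFiniteIntegralLevel 2 M) (π : CuspidalAutomorphicRepData 2 M hM),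
    ∀ᶠ w : HeightOneSpectrum (𝓞 M) in cofinite, ∃ α : Multiset ℂ,
      π.1.HasSatakeParamAt w α ∧ τ.IsUnramifiedAt w ∧ τ.HasFrobCharpolyAt w (satakePolynomial α)

/-- The ARTIN hypotheses of the crux on the pair `(τ, τ₃)`: `τ₃` is the entrywise `ι`-avatar of
`τ`, has finite image, and projective image `≃ A₅`. Verbatim the crux's three hypotheses. -/
def IsIcosahedralAvatar (ι : PadicAlgCl 3 ≃+* ℂ) (τ : FramedGaloisRep M ℂ 2)
    (τ₃ : FramedGaloisRep M (PadicAlgCl 3) 2) : Prop :=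
  (∀ g : absoluteGaloisGroup M,
      ((τ₃ g : GL (Fin 2) (PadicAlgCl 3)) : Matrix (Fin 2) (Fin 2) (PadicAlgCl 3)).map ι =
        ((τ g : GL (Fin 2) ℂ) : Matrix (Fin 2) (Fin 2) ℂ)) ∧
    Finite τ₃.toMonoidHom.range ∧
      Nonempty ((Matrix.ProjGenLinGroup.mk.comp τ₃.toMonoidHom).range ≃* alternatingGroup (Fin 5))

/-- The `p`-ADIC hypothesis `H` of the crux: `τ₃` is 3-adically automorphic of some `S`-good tame
level (a continuous `ℚ̄₃`-point of `𝕋(U^p)` associated with `τ₃`). Verbatim. -/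
def IsPadicallyAutomorphicSomeLevel (τ₃ : FramedGaloisRep M (PadicAlgCl 3) 2) : Prop :=
  ∃ 𝒰 : TameLevel 2 M 3, 𝒰.IsPadicallyAutomorphic τ₃

end Vocabulary

/-- Unbundling: the crux is `∀ ι M (CM) τ τ₃, Artin hyps → H → automorphic a.e.`. [bookkeeping] -/
theorem artinPointClassicalityCM_iff :
    ArtinPointClassicalityCM ↔
      ∀ (ι : PadicAlgCl 3 ≃+* ℂ) (M : Type) [Field M] [NumberField M], IsCMField M →
        ∀ (τ : FramedGaloisRep M ℂ 2) (τ₃ : FramedGaloisRep M (PadicAlgCl 3) 2),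
          IsIcosahedralAvatar ι τ τ₃ → IsPadicallyAutomorphicSomeLevel τ₃ → IsAutomorphicAE τ := by
  constructor
  · intro h ι M _ _ hCM τ τ₃ hA hP
    exact h ι M hCM τ τ₃ hA.1 hA.2.1 hA.2.2 hP
  · intro h ι M _ _ hCM τ τ₃ hav hfin hico hP
    exact h ι M hCM τ τ₃ ⟨hav, hfin, hico⟩ hP

/-! ## D1 — the Buzzard–Taylor transfer: companion points, gluing, residue -/

section D1

variable {M : Type} [Field M] [NumberField M]

/-- `τ₃` is **3-distinguished**: unramified at every `w ∣ 3` with DISTINCT (characteristic-zero)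
Frobenius eigenvalues — `charpoly = X² − tX + d`, `t² ≠ 4d` (Buzzard 2003's hypothesis `α ≠ β`;
the route's engine uses the residual form `‖t² − 4d‖ = 1`, which implies this one). -/
def IsThreeDistinguished (τ₃ : FramedGaloisRep M (PadicAlgCl 3) 2) : Prop :=
  ∀ w : HeightOneSpectrum (𝓞 M), (3 : 𝓞 M) ∈ w.asIdeal →
    τ₃.IsUnramifiedAt w ∧ ∃ t d : PadicAlgCl 3,
      τ₃.HasFrobCharpolyAt w (X ^ 2 - C t * X + C d) ∧ t ^ 2 ≠ 4 * d

/-- An **ordinary refinement** of `τ₃`: at each `w ∣ 3` a root `φ w` of the arithmetic-Frobenius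
characteristic polynomial of `τ₃` (values of `φ` off the places above `3` are irrelevant). -/
def IsRefinement (τ₃ : FramedGaloisRep M (PadicAlgCl 3) 2)
    (φ : HeightOneSpectrum (𝓞 M) → PadicAlgCl 3) : Prop :=
  ∀ w : HeightOneSpectrum (𝓞 M), (3 : 𝓞 M) ∈ w.asIdeal →
    ∃ t d : PadicAlgCl 3, τ₃.HasFrobCharpolyAt w (X ^ 2 - C t * X + C d) ∧
      φ w ^ 2 - t * φ w + d = 0

/-- **The companion point of the refinement `φ`**: a continuous `ℚ̄₃`-point `x` of Hida's ordinary
big Hecke algebra `𝕋^{S,ord}(𝒰)` (`OrdinaryHeckeAlgebraGLn`, some `S`-good tame level `𝒰`),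
ord-associated with `τ₃` (`IsOrdAssociated`: `charpoly τ₃(Frob_w) = x(P_w)` at the good places),
whose `U_{w,1}`-eigenvalue at every `w ∣ 3` is `φ w`.  Over `ℚ` this is the overconvergent
`p`-stabilised companion `f_α` / `f_β` of Buzzard–Taylor (arXiv:math/9905207) read in Hida's
ordinary Hecke algebra; NORMALISATION CAVEAT (census §4 D1): the identification "`U_{w,1}`-eigenvalue
= a root of the ARITHMETIC Frobenius polynomial" is the Hida/ACC+ dictionary up to `φ ↦ φ⁻¹`
(geometric Frobenius ↔ `ϖ_w`); a planner filing this piece must pin it against ACC+ §5 first. -/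
def HasCompanionPoint (τ₃ : FramedGaloisRep M (PadicAlgCl 3) 2)
    (φ : HeightOneSpectrum (𝓞 M) → PadicAlgCl 3) : Prop :=
  ∃ (𝒰 : TameLevel 2 M 3) (x : OrdinaryHeckeAlgebraGLn 𝒰 →+* PadicAlgCl 3),
    Continuous x ∧ 𝒰.IsOrdAssociated x τ₃ ∧
      ∀ w : HeightOneSpectrum (𝓞 M), (3 : 𝓞 M) ∈ w.asIdeal → x (𝒰.ordT w 1) = φ w

end D1

/-- **D1·X₁ `CompanionPointsCM`** (the `p`-adic piece; CM analogue of Buzzard–Taylor §2–3 /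
Breuil–Emerton "companion ⟺ split at `p`"): a 3-adically automorphic (`𝕋(U^p)`-point) finite-image
`τ₃` over a CM field with projective image `A₅`, 3-distinguished, has a companion point on
`𝕋^{S,ord}` for EVERY ordinary refinement.  Not implied by `Langlands` (it is a statement about
completed cohomology); attackable by the engine family of `ProAutomorphyAtKleinPrime` (Λ-adic
`R^{ord} = 𝕋^{ord}` at each residual refinement) PLUS the mod-`3` companion/Serre-weight input over
CM fields (open). -/
def CompanionPointsCM : Prop :=
  ∀ (M : Type) [Field M] [NumberField M], IsCMField M →
    ∀ τ₃ : FramedGaloisRep M (PadicAlgCl 3) 2, Finite τ₃.toMonoidHom.range →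
      Nonempty ((Matrix.ProjGenLinGroup.mk.comp τ₃.toMonoidHom).range ≃* alternatingGroup (Fin 5)) →
        IsPadicallyAutomorphicSomeLevel τ₃ → IsThreeDistinguished τ₃ →
          ∀ φ : HeightOneSpectrum (𝓞 M) → PadicAlgCl 3, IsRefinement τ₃ φ → HasCompanionPoint τ₃ φ

/-- **D1·X₂ `OrdinaryGluingCM`** (the WALL, sharpened: CM transplant of Buzzard 2003 Thm 1.1 /
Kassaei–Pilloni–Stroh gluing): if EVERY ordinary refinement of the 3-distinguished Artin avatar
`τ₃` carries a companion point, then `τ` is automorphic.  Over `ℚ` / totally real fields the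
hypothesis is exactly the input of the rigid-analytic gluing on the Shimura variety; over a CM
field there is no variety, no sheaf `ω`, no overconvergence — no mechanism is known or proposed. -/
def OrdinaryGluingCM : Prop :=
  ∀ (ι : PadicAlgCl 3 ≃+* ℂ) (M : Type) [Field M] [NumberField M], IsCMField M →
    ∀ (τ : FramedGaloisRep M ℂ 2) (τ₃ : FramedGaloisRep M (PadicAlgCl 3) 2),
      IsIcosahedralAvatar ι τ τ₃ → IsThreeDistinguished τ₃ →
        (∀ φ : HeightOneSpectrum (𝓞 M) → PadicAlgCl 3, IsRefinement τ₃ φ → HasCompanionPoint τ₃ φ) →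
          IsAutomorphicAE τ

/-- **D1·X₃ `NonDistinguishedResidueCM`** (residue): the crux on the locus where `τ₃` is ramified
at some `w ∣ 3` or has a repeated Frobenius eigenvalue there — the case NOT covered by
Buzzard–Taylor / Calegari–Geraghty even over `ℚ` (weight-one `α = β`). -/
def NonDistinguishedResidueCM : Prop :=
  ∀ (ι : PadicAlgCl 3 ≃+* ℂ) (M : Type) [Field M] [NumberField M], IsCMField M →
    ∀ (τ : FramedGaloisRep M ℂ 2) (τ₃ : FramedGaloisRep M (PadicAlgCl 3) 2),
      IsIcosahedralAvatar ι τ τ₃ → IsPadicallyAutomorphicSomeLevel τ₃ → ¬ IsThreeDistinguished τ₃ →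
        IsAutomorphicAE τ

/-- **Assembly of D1** — and the reason it is a TRIVIAL SEAM: excluded middle on
`IsThreeDistinguished`, then composition `X₂ ∘ X₁` on one branch and `X₃` on the other.
Four lines; no mathematics crosses the seam. -/
theorem artinPointClassicalityCM_of_companions (h₁ : CompanionPointsCM) (h₂ : OrdinaryGluingCM)
    (h₃ : NonDistinguishedResidueCM) : ArtinPointClassicalityCM := by
  rw [artinPointClassicalityCM_iff]
  intro ι M _ _ hCM τ τ₃ hA hP
  by_cases hd : IsThreeDistinguished τ₃
  · exact h₂ ι M hCM τ τ₃ hA hd fun φ hφ => h₁ M hCM τ₃ hA.2.1 hA.2.2 hP hd φ hφ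
  · exact h₃ ι M hCM τ τ₃ hA hP hd

/-- Conversely the two conclusion-bearing pieces are RESTRICTIONS of the crux (so `X₂ ∧ X₃` is the
crux cut along the predicate "3-distinguished with all companions", up to `X₁`). -/
theorem residue_of_artinPointClassicalityCM (h : ArtinPointClassicalityCM) :
    NonDistinguishedResidueCM := by
  rw [artinPointClassicalityCM_iff] at h
  exact fun ι M _ _ hCM τ τ₃ hA hP _ => h ι M hCM τ τ₃ hA hP

/-! ## D2 — Galois-type sectors (odd-descending / non-odd-descending / genuine) -/

section D2

variable (M : Type) [Field M] [NumberField M]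

/-- `τ` **descends to a totally real quadratic subfield up to twist, through `σ₀`**: `F ⊂ M`
totally real with `[M : F] = 2` (for `M` CM this is `M⁺`), `σ₀ : Γ_F → GL₂(ℂ)`, `χ : Γ_M → ℂ^×`,
and `τ = χ ⊗ σ₀|_M` entrywise.  For projectively-`A₅` `τ` this is EQUIVALENT to polarizability
`τᶜ ≃ τ^∨ ⊗ μ` (the projective representation extends across `Gal(M/M⁺)` iff it is `c`-stable,
because `Cent_{PGL₂}(A₅) = 1` and `H²(Γ_{M⁺}, ℂ^×) = 0`, Tate) — census §4 D2. -/
def DescendsVia (τ : FramedGaloisRep M ℂ 2) (F : Type) [Field F] [NumberField F] [Algebra F M]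
    (σ₀ : FramedGaloisRep F ℂ 2) : Prop :=
  IsTotallyReal F ∧ Module.finrank F M = 2 ∧
    ∃ χ : FramedGaloisRep M ℂ 1, ∀ g : absoluteGaloisGroup M,
      ((τ g : GL (Fin 2) ℂ) : Matrix (Fin 2) (Fin 2) ℂ) =
        ((Matrix.GeneralLinearGroup.det (χ g) : ℂˣ) : ℂ) •
          ((σ₀.restrictField M g : GL (Fin 2) ℂ) : Matrix (Fin 2) (Fin 2) ℂ)

/-- `σ₀ : Γ_F → GL₂(ℂ)` is **totally odd**: `det σ₀(c) = −1` for every complex conjugation of `F`. -/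
def IsTotallyOdd {F : Type} [Field F] (σ₀ : FramedGaloisRep F ℂ 2) : Prop :=
  ∀ (φ : F →+* ℝ) (c : absoluteGaloisGroup F), IsComplexConjugation φ c →
    Matrix.GeneralLinearGroup.det (σ₀ c) = -1

/-- `τ` descends up to twist to SOME `σ₀` over a totally real quadratic subfield. -/
def Descends (τ : FramedGaloisRep M ℂ 2) : Prop :=
  ∃ (F : Type) (_ : Field F) (_ : NumberField F) (_ : Algebra F M) (σ₀ : FramedGaloisRep F ℂ 2),
    DescendsVia M τ F σ₀

/-- `τ` descends up to twist to a TOTALLY ODD `σ₀`. -/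
def DescendsToOdd (τ : FramedGaloisRep M ℂ 2) : Prop :=
  ∃ (F : Type) (_ : Field F) (_ : NumberField F) (_ : Algebra F M) (σ₀ : FramedGaloisRep F ℂ 2),
    DescendsVia M τ F σ₀ ∧ IsTotallyOdd σ₀

end D2

/-- **D2·S `OddDescendingSector`**: the crux on the sector `τ = χ ⊗ σ₀|_M`, `σ₀` totally odd over
`M⁺`.  CLOSABLE FROM PRINT without the `p`-adic hypothesis: Sasaki 2019 (Invent. Math. 215,
doi:10.1007/s00222-018-0825-x; with Kassaei–Sasaki–Tian 2014, Pilloni 2017, Pilloni–Stroh 2016)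
— strong Artin for totally odd `σ₀` over totally real `F` —, Langlands' quadratic base change
`F → M` (tree facts `ArthurClozel1989_*` / `baseChange_cyclic_cuspidal`) and twisting by the
Hecke character of `χ` (`artinReciprocity_character_holds`, `CuspidalAutomorphicRepData.twist`).
A support item (Literature debt), not a crux. -/
def OddDescendingSector : Prop :=
  ∀ (ι : PadicAlgCl 3 ≃+* ℂ) (M : Type) [Field M] [NumberField M], IsCMField M →
    ∀ (τ : FramedGaloisRep M ℂ 2) (τ₃ : FramedGaloisRep M (PadicAlgCl 3) 2),
      IsIcosahedralAvatar ι τ τ₃ → IsPadicallyAutomorphicSomeLevel τ₃ → DescendsToOdd M τ →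
        IsAutomorphicAE τ

/-- **D2·E `NonOddDescendingSector`**: the crux on the sector `τ = χ ⊗ σ₀|_M` with `σ₀` over `M⁺`
NOT totally odd (even at ≥ 1 real place).  Contains EVERY instance the route's `closes` feeds to the
crux (`τ|_{M'}`, `τ = χ ⊗ σ|_M`, `σ` EVEN icosahedral over `ℚ`: `σ|_{M'⁺}` is totally even), and on
those instances it FOLLOWS from the route's target `EvenIcosahedralStrongArtin` by Arthur–Clozel
base change + twisting with the `p`-adic hypothesis UNUSED — target-strength modulo print
(census §4 D2).  The even `σ₀` are invisible to every Shimura variety over `M⁺` (Maass type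
`λ = 1/4` at the even places): this is the wall. -/
def NonOddDescendingSector : Prop :=
  ∀ (ι : PadicAlgCl 3 ≃+* ℂ) (M : Type) [Field M] [NumberField M], IsCMField M →
    ∀ (τ : FramedGaloisRep M ℂ 2) (τ₃ : FramedGaloisRep M (PadicAlgCl 3) 2),
      IsIcosahedralAvatar ι τ τ₃ → IsPadicallyAutomorphicSomeLevel τ₃ →
        Descends M τ → ¬ DescendsToOdd M τ → IsAutomorphicAE τ

/-- **D2·G `GenuineSector`**: the crux on the GENUINE sector — `τ` is not a twist of a base
change from `M⁺` (equivalently non-polarizable).  Never instantiated by the route; no host of any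
kind (HLTT-type doubling to `U(2,2)` meets totally degenerate limits of discrete series /
Harris–Zucker boundary cohomology with algebraic coefficients, census §3 S4). -/
def GenuineSector : Prop :=
  ∀ (ι : PadicAlgCl 3 ≃+* ℂ) (M : Type) [Field M] [NumberField M], IsCMField M →
    ∀ (τ : FramedGaloisRep M ℂ 2) (τ₃ : FramedGaloisRep M (PadicAlgCl 3) 2),
      IsIcosahedralAvatar ι τ τ₃ → IsPadicallyAutomorphicSomeLevel τ₃ → ¬ Descends M τ →
        IsAutomorphicAE τ

/-- **Assembly of D2** — a TRIVIAL SEAM: excluded middle on `DescendsToOdd` and `Descends`. -/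
theorem artinPointClassicalityCM_of_sectors (hS : OddDescendingSector) (hE : NonOddDescendingSector)
    (hG : GenuineSector) : ArtinPointClassicalityCM := by
  rw [artinPointClassicalityCM_iff]
  intro ι M _ _ hCM τ τ₃ hA hP
  by_cases hodd : DescendsToOdd M τ
  · exact hS ι M hCM τ τ₃ hA hP hodd
  · by_cases hdesc : Descends M τ
    · exact hE ι M hCM τ τ₃ hA hP hdesc hodd
    · exact hG ι M hCM τ τ₃ hA hP hdesc

/-- Each sector is the crux RESTRICTED — so `S ∧ E ∧ G ↔ crux`, the signature of a cut along a
trivial seam. -/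
theorem sectors_of_artinPointClassicalityCM (h : ArtinPointClassicalityCM) :
    OddDescendingSector ∧ NonOddDescendingSector ∧ GenuineSector := by
  rw [artinPointClassicalityCM_iff] at h
  exact ⟨fun ι M _ _ hCM τ τ₃ hA hP _ => h ι M hCM τ τ₃ hA hP,
    fun ι M _ _ hCM τ τ₃ hA hP _ _ => h ι M hCM τ τ₃ hA hP,
    fun ι M _ _ hCM τ τ₃ hA hP _ => h ι M hCM τ τ₃ hA hP⟩

/-- `S ∧ E ∧ G ↔ crux`. -/
theorem sectors_iff : (OddDescendingSector ∧ NonOddDescendingSector ∧ GenuineSector) ↔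
    ArtinPointClassicalityCM :=
  ⟨fun h => artinPointClassicalityCM_of_sectors h.1 h.2.1 h.2.2, sectors_of_artinPointClassicalityCM⟩

end Summit.Langlands.Langlands.Cruxes.ArtinPointClassicalityCM.StrategyCensus

end
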